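import Summits.NavierStokesRegularity.TurbBounds.ShearSpecLadder
import HarnessLib

/-!
# The per-mode assembly of rbsdp SPEC 2.7–2.9 at the algebraic level (fw16): `G_m ≥ (A_m − κ̃_m T)·‖w̃₂‖²` from the certified block

Cell `turb-bounds` (pub-turb), shear lane, pub-turb-shear gen 6 (2026-08-22); v2 lane. ALGEBRA on coefficient data: two real components
`c₁, c₂ : ℕ → ℝ` (Legendre coefficients of `W₁″, W₂″`, `W = W₁ + iW₂`) with ladders `a_i, b_i` and wall relations (`W′(−1) = 0`:
`a_i 0 = c_i 0 − c_i 1/3`; `W(−1) = 0`: `b_i 0 = a_i 0 − a_i 1/3`; `W(1) = 0`: `c_i 0 = c_i 1/3` = SPEC 2.8's projection), mode data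
`(N, P)`, rational `A, C, D` (the rule's `A_m, C_m, D_m`), `δ = delta N`, profile `φ̂` (any reals), `T ≥ 0`, windows of length `L` for the tails
and a coupling-tail number `X_t` obeying the Young bound of SPEC 2.7.
* `omegaOf L2 c₁ c₂` — block coordinates (`ω_i = c₁(i+1)`, `ω_{L2−1+i} = c₂(i+1)`); `projLin_omegaOf_fst/snd` : `blkdiag(A,A)·ω = (c₁; c₂)`;
* **`mode_assembly`**: `ωᵀQ_m(φ̂,T)ω ≥ 0` (the kernel's `rule_posSemidef`, piecewise) ⇒
  `(A − κ̃T)·(T2₁+T2₂) ≤ Σ_i c_iᵀQ1c_i + A·ΣT2 + 8·ΣT1 + C·ΣT0 − D·(X_fin + X_t)`, `X_fin = Σ_p φ̂_p (c₁ᵀE⁽ᵖ⁾c₂ − c₂ᵀE⁽ᵖ⁾c₁)`,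
  `κ̃ = D((δ/2)λ0 + λ1/(2δ))`; with the row's `TailSlack` (`A − κ̃T ≥ 0`) the right side — which `ShearBridgeNorms.norms_split` + the cross-term
  identity identify with SPEC 2.2's `G_m{W}` for polynomial `W` — is `≥ 0` (`mode_assembly_nonneg`). SPEC 2.9 modulo analysis.
HONEST FRAMING: rigorous bounds for the stated PDE and boundary conditions; no claim about physical turbulence beyond the bound.
-/

set_option linter.style.longLine false

namespace Summit.NavierStokesRegularity.TurbBounds.ShearSpecPieces

open Finset Summit.NavierStokesRegularity.TurbBounds.LadderTail Summit.NavierStokesRegularity.TurbBounds.ShearTailSeq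

/-! ### congruence of the forms in the vector (only indices `< n` matter) -/

/-- `bform` depends only on the values below `n`. -/
theorem bform_congr (M : List (List ℚ)) (n : ℕ) {x x' y y' : ℕ → ℝ} (hx : ∀ i < n, x i = x' i) (hy : ∀ j < n, y j = y' j) :
    bform M n x y = bform M n x' y' := by
  unfold bform
  exact Finset.sum_congr rfl fun i hi => Finset.sum_congr rfl fun j hj => by
    rw [hx i (by simpa using hi), hy j (by simpa using hj)]

/-- `qform` depends only on the values below `n`. -/
theorem qform_congr (M : List (List ℚ)) (n : ℕ) {x x' : ℕ → ℝ} (hx : ∀ i < n, x i = x' i) : qform M n x = qform M n x' :=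
  bform_congr M n hx hx

/-! ### the block coordinates of a pair of coefficient vectors -/

/-- `ω` for the pair `(c₁, c₂)`: `ω_i = c₁(i+1)` for `i < L2−1`, `ω_{L2−1+i} = c₂(i+1)`. -/
def omegaOf (L2 : ℕ) (c₁ c₂ : ℕ → ℝ) (i : ℕ) : ℝ := if i < L2 - 1 then c₁ (i + 1) else c₂ (i - (L2 - 1) + 1)

/-- `(Pω)_r = c₁ r` for `r < L2` (wall relation `c₁ 0 = c₁ 1/3`). -/
theorem projLin_omegaOf_fst (L2 : ℕ) (hL : 2 ≤ L2) {c₁ c₂ : ℕ → ℝ} (hw : c₁ 0 = c₁ 1 / 3) (r : ℕ) (hr : r < L2) :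
    projLin L2 (omegaOf L2 c₁ c₂) r = c₁ r := by
  rw [projLin_eq L2 hL _ r (by omega)]
  unfold omegaOf
  by_cases h0 : r = 0
  · subst h0; simp [show (0 : ℕ) < L2 - 1 by omega, hw]
  · rw [if_neg h0, if_pos hr, if_pos (by omega), show r - 1 + 1 = r by omega]

/-- `(Pω)_{L2+s} = c₂ s` for `s < L2` (wall relation `c₂ 0 = c₂ 1/3`). -/
theorem projLin_omegaOf_snd (L2 : ℕ) (hL : 2 ≤ L2) {c₁ c₂ : ℕ → ℝ} (hw : c₂ 0 = c₂ 1 / 3) (s : ℕ) (hs : s < L2) :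
    projLin L2 (omegaOf L2 c₁ c₂) (L2 + s) = c₂ s := by
  rw [projLin_eq L2 hL _ (L2 + s) (by omega)]
  unfold omegaOf
  by_cases h0 : s = 0
  · subst h0
    rw [if_neg (by omega), if_neg (by omega), if_pos (by omega), if_neg (by omega), show L2 - 1 - (L2 - 1) + 1 = 1 by omega, hw]
  · rw [if_neg (by omega), if_neg (by omega), if_neg (by omega), if_neg (by omega),
      show L2 + s - 2 - (L2 - 1) + 1 = s by omega]

/-! ### the assembly -/

/-- **SPEC 2.7–2.9, algebraic assembly for one mode** (see the file header). -/
theorem mode_assembly (N P : ℕ) (A C D : ℚ) (T : ℝ) (phi : ℕ → ℝ) {c₁ a₁ b₁ c₂ a₂ b₂ : ℕ → ℝ}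
    (hA₁ : IsLadder c₁ a₁) (h0a₁ : a₁ 0 = c₁ 0 - c₁ 1 / 3) (hB₁ : IsLadder a₁ b₁) (hw₁ : c₁ 0 = c₁ 1 / 3)
    (hA₂ : IsLadder c₂ a₂) (h0a₂ : a₂ 0 = c₂ 0 - c₂ 1 / 3) (hB₂ : IsLadder a₂ b₂) (hw₂ : c₂ 0 = c₂ 1 / 3)
    (L : ℕ) {Xt : ℝ} (hC : 0 ≤ (C : ℝ)) (hD : 0 ≤ (D : ℝ)) (hT : 0 ≤ T)
    (hX : |Xt| ≤ T * ((delta N : ℝ) / 2 * (∑ k ∈ range L, w (N + 1 + k) * b₁ (N + 1 + k) ^ 2 + ∑ k ∈ range L, w (N + 1 + k) * b₂ (N + 1 + k) ^ 2)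
          + (∑ k ∈ range L, w (N + 2 + k) * a₁ (N + 2 + k) ^ 2 + ∑ k ∈ range L, w (N + 2 + k) * a₂ (N + 2 + k) ^ 2) / (2 * (delta N : ℝ))))
    (hQ : 0 ≤ qform (q0Piece N P A C) (2 * (N + P + 4 - 1)) (omegaOf (N + P + 4) c₁ c₂)
          + ∑ p ∈ range (P + 1), phi p * qform (qphiPiece N P D p) (2 * (N + P + 4 - 1)) (omegaOf (N + P + 4) c₁ c₂)
          + T * qform (qtPiece N P D) (2 * (N + P + 4 - 1)) (omegaOf (N + P + 4) c₁ c₂)) :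
    ((A : ℝ) - (D : ℝ) * ((delta N : ℝ) / 2 * lam0 N P + lam1 N P / (2 * (delta N : ℝ))) * T)
        * (∑ k ∈ range L, w (N + P + 4 + k) * c₁ (N + P + 4 + k) ^ 2 + ∑ k ∈ range L, w (N + P + 4 + k) * c₂ (N + P + 4 + k) ^ 2)
      ≤ (qform (q1Tab N P A C) (N + P + 4) c₁ + qform (q1Tab N P A C) (N + P + 4) c₂)
        + ((A : ℝ) * (∑ k ∈ range L, w (N + P + 4 + k) * c₁ (N + P + 4 + k) ^ 2 + ∑ k ∈ range L, w (N + P + 4 + k) * c₂ (N + P + 4 + k) ^ 2)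
           + 8 * (∑ k ∈ range L, w (N + 2 + k) * a₁ (N + 2 + k) ^ 2 + ∑ k ∈ range L, w (N + 2 + k) * a₂ (N + 2 + k) ^ 2)
           + (C : ℝ) * (∑ k ∈ range L, w (N + 1 + k) * b₁ (N + 1 + k) ^ 2 + ∑ k ∈ range L, w (N + 1 + k) * b₂ (N + 1 + k) ^ 2))
        - (D : ℝ) * ((∑ p ∈ range (P + 1), phi p * (bform (eTab N P p) (N + P + 4) c₁ c₂ - bform (eTab N P p) (N + P + 4) c₂ c₁)) + Xt) := by
  have hL : 2 ≤ N + P + 4 := by omega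
  -- the projection identifies (Pω) with (c₁; c₂) on the index ranges used by the forms
  have hfst : ∀ r < N + P + 4, projLin (N + P + 4) (omegaOf (N + P + 4) c₁ c₂) r = c₁ r := projLin_omegaOf_fst _ hL hw₁
  have hsnd : ∀ s < N + P + 4, (fun s => projLin (N + P + 4) (omegaOf (N + P + 4) c₁ c₂) (N + P + 4 + s)) s = c₂ s :=
    projLin_omegaOf_snd _ hL hw₂
  -- the three piece families as forms of c₁, c₂
  have e0 : qform (q0Piece N P A C) (2 * (N + P + 4 - 1)) (omegaOf (N + P + 4) c₁ c₂)
      = qform (q1Tab N P A C) (N + P + 4) c₁ + qform (q1Tab N P A C) (N + P + 4) c₂ := by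
    rw [qform_q0Piece, qform_congr _ _ hfst, qform_congr _ _ hsnd]
  have eT : qform (qtPiece N P D) (2 * (N + P + 4 - 1)) (omegaOf (N + P + 4) c₁ c₂)
      = -(qform (rTab N P D) (N + P + 4) c₁ + qform (rTab N P D) (N + P + 4) c₂) := by
    rw [qform_qtPiece, qform_congr _ _ hfst, qform_congr _ _ hsnd]
  have eP : ∀ p, qform (qphiPiece N P D p) (2 * (N + P + 4 - 1)) (omegaOf (N + P + 4) c₁ c₂)
      = (D : ℝ) * (bform (eTab N P p) (N + P + 4) c₂ c₁ - bform (eTab N P p) (N + P + 4) c₁ c₂) := by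
    intro p
    rw [qform_qphiPiece, bform_congr _ _ hsnd hfst, bform_congr _ _ hfst hsnd]
  -- R as tail forms
  have hR : ∀ {c a : ℕ → ℝ}, IsLadder c a → a 0 = c 0 - c 1 / 3 →
      qform (rTab N P D) (N + P + 4) c = (D : ℝ) * ((delta N : ℝ) / 2 * H0form N P c a + 1 / (2 * (delta N : ℝ)) * H1form N P c) := by
    intro c a hA h0
    rw [qform_rTab, ← H0form_eq_qform (P := P) hA h0, ← H1form_eq_qform]
  have hR₁ := hR hA₁ h0a₁
  have hR₂ := hR hA₂ h0a₂
  -- the tail lemma (Young form, both components)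
  have hδ : 0 < (delta N : ℝ) := by unfold delta; push_cast; positivity
  have hrem := rem_lower_bound_young (A := (A : ℝ)) (C := (C : ℝ)) (D := (D : ℝ)) (T := T) (δ := (delta N : ℝ)) (Xt := Xt)
    hC hD hT hδ
    (add_nonneg (window_nonneg a₁ (N + 2) L) (window_nonneg a₂ (N + 2) L))
    (add_nonneg (window_nonneg b₁ (N + 1) L) (window_nonneg b₂ (N + 1) L))
    (pair_tail1_bound hA₁ hA₂ N P L) (pair_tail0_bound hA₁ hB₁ hA₂ hB₂ N P L) hX
  -- rewrite hQ with the three identities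
  rw [e0, eT, Finset.sum_congr rfl fun p _ => by rw [eP p]] at hQ
  rw [hR₁, hR₂] at hQ
  -- the profile sum: Σ φ̂_p · D·(b₂₁ − b₁₂) = −D · Σ φ̂_p (b₁₂ − b₂₁)
  have hsum : ∑ p ∈ range (P + 1), phi p * ((D : ℝ) * (bform (eTab N P p) (N + P + 4) c₂ c₁ - bform (eTab N P p) (N + P + 4) c₁ c₂))
      = -((D : ℝ) * ∑ p ∈ range (P + 1), phi p * (bform (eTab N P p) (N + P + 4) c₁ c₂ - bform (eTab N P p) (N + P + 4) c₂ c₁)) := by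
    rw [Finset.mul_sum, ← Finset.sum_neg_distrib]
    exact Finset.sum_congr rfl fun p _ => by ring
  rw [hsum] at hQ
  -- the T·R terms of hQ are exactly the subtracted term of the tail lemma
  have key : T * (-((D : ℝ) * ((delta N : ℝ) / 2 * H0form N P c₁ a₁ + 1 / (2 * (delta N : ℝ)) * H1form N P c₁)
        + (D : ℝ) * ((delta N : ℝ) / 2 * H0form N P c₂ a₂ + 1 / (2 * (delta N : ℝ)) * H1form N P c₂)))
      = -(T * ((D : ℝ) * ((delta N : ℝ) / 2 * (H0form N P c₁ a₁ + H0form N P c₂ a₂) + (H1form N P c₁ + H1form N P c₂) / (2 * (delta N : ℝ))))) := by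
    ring
  rw [key] at hQ
  linarith [hQ, hrem]

/-- **`G_m ≥ 0` at the algebraic level**: with the row's tail slack `A − κ̃T ≥ 0` the right-hand side of `mode_assembly` is nonnegative. -/
theorem mode_assembly_nonneg (N P : ℕ) (A C D : ℚ) (T : ℝ) (phi : ℕ → ℝ) {c₁ a₁ b₁ c₂ a₂ b₂ : ℕ → ℝ}
    (hA₁ : IsLadder c₁ a₁) (h0a₁ : a₁ 0 = c₁ 0 - c₁ 1 / 3) (hB₁ : IsLadder a₁ b₁) (hw₁ : c₁ 0 = c₁ 1 / 3)
    (hA₂ : IsLadder c₂ a₂) (h0a₂ : a₂ 0 = c₂ 0 - c₂ 1 / 3) (hB₂ : IsLadder a₂ b₂) (hw₂ : c₂ 0 = c₂ 1 / 3)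
    (L : ℕ) {Xt : ℝ} (hC : 0 ≤ (C : ℝ)) (hD : 0 ≤ (D : ℝ)) (hT : 0 ≤ T)
    (hX : |Xt| ≤ T * ((delta N : ℝ) / 2 * (∑ k ∈ range L, w (N + 1 + k) * b₁ (N + 1 + k) ^ 2 + ∑ k ∈ range L, w (N + 1 + k) * b₂ (N + 1 + k) ^ 2)
          + (∑ k ∈ range L, w (N + 2 + k) * a₁ (N + 2 + k) ^ 2 + ∑ k ∈ range L, w (N + 2 + k) * a₂ (N + 2 + k) ^ 2) / (2 * (delta N : ℝ))))
    (hslack : 0 ≤ (A : ℝ) - (D : ℝ) * ((delta N : ℝ) / 2 * lam0 N P + lam1 N P / (2 * (delta N : ℝ))) * T)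
    (hQ : 0 ≤ qform (q0Piece N P A C) (2 * (N + P + 4 - 1)) (omegaOf (N + P + 4) c₁ c₂)
          + ∑ p ∈ range (P + 1), phi p * qform (qphiPiece N P D p) (2 * (N + P + 4 - 1)) (omegaOf (N + P + 4) c₁ c₂)
          + T * qform (qtPiece N P D) (2 * (N + P + 4 - 1)) (omegaOf (N + P + 4) c₁ c₂)) :
    0 ≤ (qform (q1Tab N P A C) (N + P + 4) c₁ + qform (q1Tab N P A C) (N + P + 4) c₂)
        + ((A : ℝ) * (∑ k ∈ range L, w (N + P + 4 + k) * c₁ (N + P + 4 + k) ^ 2 + ∑ k ∈ range L, w (N + P + 4 + k) * c₂ (N + P + 4 + k) ^ 2)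
           + 8 * (∑ k ∈ range L, w (N + 2 + k) * a₁ (N + 2 + k) ^ 2 + ∑ k ∈ range L, w (N + 2 + k) * a₂ (N + 2 + k) ^ 2)
           + (C : ℝ) * (∑ k ∈ range L, w (N + 1 + k) * b₁ (N + 1 + k) ^ 2 + ∑ k ∈ range L, w (N + 1 + k) * b₂ (N + 1 + k) ^ 2))
        - (D : ℝ) * ((∑ p ∈ range (P + 1), phi p * (bform (eTab N P p) (N + P + 4) c₁ c₂ - bform (eTab N P p) (N + P + 4) c₂ c₁)) + Xt) := by
  have h := mode_assembly N P A C D T phi hA₁ h0a₁ hB₁ hw₁ hA₂ h0a₂ hB₂ hw₂ L hC hD hT hX hQ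
  have hT2 : 0 ≤ ∑ k ∈ range L, w (N + P + 4 + k) * c₁ (N + P + 4 + k) ^ 2 + ∑ k ∈ range L, w (N + P + 4 + k) * c₂ (N + P + 4 + k) ^ 2 :=
    add_nonneg (window_nonneg c₁ (N + P + 4) L) (window_nonneg c₂ (N + P + 4) L)
  exact le_trans (mul_nonneg hslack hT2) h

end Summit.NavierStokesRegularity.TurbBounds.ShearSpecPieces
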